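import Summits.CriticalPhenomena.PercolationContinuityZ3.Theorems.FK.BoxLimitSemicontinuity
import Summits.CriticalPhenomena.PercolationContinuityZ3.Theorems.FK.FreeWiredCoincidence
import Summits.CriticalPhenomena.PercolationContinuityZ3.Theorems.FK.FreeWiredCriticalPoint
import Mathlib.Topology.Algebra.Module.Cardinality
import HarnessLib

/-!
# FK-continuity cell, FO-10a: the free and wired percolation probabilities INTERLACE —
# `θ¹(p,q) ≤ θ⁰(p',q)` for `p < p'`, `θ⁰(p+) = θ¹(p)`; continuity of `θ⁰(·,q)` or `θ¹(·,q)` at `p` forces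
# `θ⁰(p,q) = θ¹(p,q)`; `T_W(q) ⟺ θ⁰(·,q)` is continuous at `p_c(q) ⟺ θ¹(·,q)` is continuous at `p_c(q)`
# (Grimmett 2006, Thm. (5.16)(b)–(d), the halves that need no left-continuity of `θ⁰`)

Registered R79 (cell INBOX l.5753, 2026-08-23); registry row FO-10a-g336t; label THI-A (coordinator fk-4 g167).
Cell `fk-continuity` (bschramm), row FO-10a (domain-Markov + comparison layer over FO-06); support file for the
FK-continuity transplant (`--supports stmt-CriticalPhenomena-4575`); builds on p205010 (kernel theorem, internal audit
signed; external expert review pending). Pure proofs; no definitions, no named facts, no sorries; general dimension `d`.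

Grimmett 2006, Thm. (5.16): (a) `θ⁰(·,q)` is left-continuous on `(0,1] ∖ {p_c(q)}` (proved via §8.8 — NOT here);
(b) `θ¹(·,q)` is right-continuous (tree: FO-10a-g335s `BoxLimitSemicontinuity.lean`); (c) `θ⁰ = θ¹ ⟺ p ∉ 𝒟_q`;
(d) for `p ≠ p_c(q)`, `θ⁰(·,q)` and `θ¹(·,q)` are continuous at `p` iff `p ∉ 𝒟_q`. This file proves the comparison
between the two boundary conditions at DIFFERENT parameters and the halves of (d) that do not need (a):

* `exists_mem_Ioo_thetaFree_eq_thetaWired` — between any `0 ≤ a < b ≤ 1` lies a parameter with `θ⁰ = θ¹`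
  (`𝒟_q` is countable, FO-07b `countable_setOf_thetaFree_ne_thetaWired`; a countable set has dense complement);
* **`thetaWired_le_thetaFree_of_lt`** — `θ¹(p,q) ≤ θ⁰(p',q)` for `0 ≤ p < p' ≤ 1` (through such a parameter in between:
  `θ¹(p) ≤ θ¹(p'') = θ⁰(p'') ≤ θ⁰(p')`), the percolation-probability analogue of `h¹(p) ≤ h⁰(p')` ((4.73)–(4.76));
* **`tendsto_thetaFree_nhdsGT`** — `θ⁰(x,q) → θ¹(p,q)` as `x ↓ p`: the right limit of the FREE percolation probability
  is the WIRED one (squeeze with (b)); `continuousWithinAt_Ioi_thetaFree_iff` — `θ⁰(·,q)` is right-continuous at `p` iff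
  `θ⁰(p,q) = θ¹(p,q)`;
* **`thetaFree_eq_thetaWired_of_continuousAt_thetaFree`**, **`thetaFree_eq_thetaWired_of_continuousAt_thetaWired`** —
  Thm. (5.16)(d), the direction "continuous ⇒ `p ∉ 𝒟_q`", for EVERY `p` (including `p_c(q)`) and either boundary
  condition, with no input from (a);
* **`fkContinuityWired_iff_continuousAt_thetaFree`**, `fkContinuityWired_iff_continuousAt_thetaWired` (`d ≥ 2`,
  `q ≥ 1`) — wired continuity at criticality `T_W(q)` IS continuity of `p ↦ θ⁰(p,q)` at `p_c(q)`, and IS continuity of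
  `p ↦ θ¹(p,q)` at `p_c(q)`.

With row FO-10a-g336's `UniquenessOfEqualTheta.lean` (`θ⁰ = θ¹ ⟺ φ⁰_{p,q} = φ¹_{p,q}`) each "`θ⁰ = θ¹`" conclusion reads
"a unique random-cluster measure"; that composition is left to the consumer (no import of the pending row here, so
that this file is proposable at once). Honest framing: unconditional structure; decides nothing about `q ∈ (1,2)`;
NOT a binder discharge, NOT `_r4`.

## References
* G. Grimmett, *The Random-Cluster Model*, Springer 2006 (`book:grimmett2006-random-cluster-model`): §5.1 (5.1)–(5.4),
  Thm. (5.16) and the paragraph after it, Thm. (4.63) [PDF pp. 98–102, 88–93]. [Grimmett2006]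
-/

noncomputable section

open MeasureTheory Set Filter
open scoped Topology ENNReal

namespace Summit.CriticalPhenomena.PercolationContinuityZ3.Theorems.FK

open Literature.Probability.Percolation Literature.Probability.LatticeModels Literature.Barriers.CriticalPhenomena

variable {d : ℕ} {p p' q : ℝ}

/-! ### A parameter of uniqueness between any two parameters -/

/-- Between any two parameters `0 ≤ a < b ≤ 1` there is one at which `θ⁰ = θ¹` (`q ≥ 1`): the exceptional set is
countable (Thm. (4.63)/(5.16)(c)) and a countable set of reals has dense complement. [cite: Grimmett2006, Thm. (4.63) with Thm. (5.16)(c)] -/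
theorem exists_mem_Ioo_thetaFree_eq_thetaWired (hq : 1 ≤ q) {a b : ℝ} (ha : 0 ≤ a) (hb : b ≤ 1) (hab : a < b) :
    ∃ x ∈ Set.Ioo a b, thetaFree d x q = thetaWired d x q := by
  have hdense := Set.Countable.dense_compl ℝ (countable_setOf_thetaFree_ne_thetaWired (d := d) hq)
  have hne : (Set.Ioo a b).Nonempty := ⟨(a + b) / 2, by constructor <;> linarith⟩
  obtain ⟨x, hxS, hxI⟩ := hdense.exists_mem_open (isOpen_Ioo (a := a) (b := b)) hne
  refine ⟨x, hxI, ?_⟩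
  by_contra hne'
  exact hxS ⟨⟨ha.trans hxI.1.le, hxI.2.le.trans hb⟩, hne'⟩

/-! ### Interlacing: `θ¹(p) ≤ θ⁰(p')` for `p < p'` -/

/-- **`θ¹(p,q) ≤ θ⁰(p',q)` whenever `0 ≤ p < p' ≤ 1`** (`q ≥ 1`): through a parameter `p < x < p'` with `θ⁰(x) = θ¹(x)`,
`θ¹(p) ≤ θ¹(x) = θ⁰(x) ≤ θ⁰(p')` (both percolation probabilities are non-decreasing in `p`).
[cite: Grimmett2006, §5.1 (5.3)–(5.4) with Thm. (4.63) and Thm. (5.16)(c)] -/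
theorem thetaWired_le_thetaFree_of_lt (hq : 1 ≤ q) (hp : p ∈ Set.Icc (0 : ℝ) 1) (hp' : p' ∈ Set.Icc (0 : ℝ) 1)
    (hlt : p < p') : thetaWired d p q ≤ thetaFree d p' q := by
  obtain ⟨x, hx, hθ⟩ := exists_mem_Ioo_thetaFree_eq_thetaWired (d := d) hq hp.1 hp'.2 hlt
  have hxI : x ∈ Set.Icc (0 : ℝ) 1 := ⟨hp.1.trans hx.1.le, hx.2.le.trans hp'.2⟩
  calc thetaWired d p q ≤ thetaWired d x q := thetaWired_mono_left d hp hxI hx.1.le hq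
    _ = thetaFree d x q := hθ.symm
    _ ≤ thetaFree d p' q := thetaFree_mono_left hxI hp' hx.2.le hq

/-! ### The right limit of `θ⁰(·,q)` is `θ¹` -/

/-- **`θ⁰(x,q) → θ¹(p,q)` as `x ↓ p`** (`0 ≤ p < 1`, `q ≥ 1`): `θ¹(p) ≤ θ⁰(x) ≤ θ¹(x)` for `x > p` and `θ¹(·,q)` is
right-continuous (Thm. (5.16)(b)). [cite: Grimmett2006, Thm. (5.16)(b) with §5.1 (5.3)] -/
theorem tendsto_thetaFree_nhdsGT (hq : 1 ≤ q) (hp : p ∈ Set.Ico (0 : ℝ) 1) :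
    Tendsto (fun x : ℝ => thetaFree d x q) (𝓝[>] p) (𝓝 (thetaWired d p q)) := by
  have hp' : p ∈ Set.Icc (0 : ℝ) 1 := ⟨hp.1, hp.2.le⟩
  have hmem : Set.Ioo p 1 ∈ 𝓝[>] p := Ioo_mem_nhdsGT hp.2
  refine tendsto_of_tendsto_of_tendsto_of_le_of_le' tendsto_const_nhds (tendsto_thetaWired_nhdsGT (d := d) hq hp) ?_ ?_
  · filter_upwards [hmem] with x hx
    exact thetaWired_le_thetaFree_of_lt hq hp' ⟨hp.1.trans hx.1.le, hx.2.le⟩ hx.1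
  · filter_upwards [hmem] with x hx
    exact thetaFree_le_thetaWired ⟨hp.1.trans hx.1.le, hx.2.le⟩ hq

/-- **`θ⁰(·,q)` is right-continuous at `p` iff `θ⁰(p,q) = θ¹(p,q)`** (`0 ≤ p < 1`, `q ≥ 1`): its right limit is
`θ¹(p,q)`. [cite: Grimmett2006, Thm. (5.16)(b)–(d)] -/
theorem continuousWithinAt_Ioi_thetaFree_iff (hq : 1 ≤ q) (hp : p ∈ Set.Ico (0 : ℝ) 1) :
    ContinuousWithinAt (fun x : ℝ => thetaFree d x q) (Set.Ioi p) p ↔ thetaFree d p q = thetaWired d p q := by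
  have h := tendsto_thetaFree_nhdsGT (d := d) hq hp
  constructor
  · intro hc
    exact tendsto_nhds_unique hc h
  · intro heq
    rw [ContinuousWithinAt, heq]
    exact h

/-! ### Continuity at `p` of either percolation probability forces `θ⁰(p) = θ¹(p)` -/

/-- **Thm. (5.16)(d), "continuous ⇒ no coexistence", free version**: if `x ↦ θ⁰(x,q)` is continuous at `p`
(`0 ≤ p < 1`, `q ≥ 1`) then `θ⁰(p,q) = θ¹(p,q)` — valid at EVERY `p`, `p_c(q)` included, with no left-continuity input.
[cite: Grimmett2006, Thm. (5.16)(d)] -/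
theorem thetaFree_eq_thetaWired_of_continuousAt_thetaFree (hq : 1 ≤ q) (hp : p ∈ Set.Ico (0 : ℝ) 1)
    (hc : ContinuousAt (fun x : ℝ => thetaFree d x q) p) : thetaFree d p q = thetaWired d p q :=
  (continuousWithinAt_Ioi_thetaFree_iff hq hp).1 hc.continuousWithinAt

/-- **Thm. (5.16)(d), "continuous ⇒ no coexistence", wired version**: if `x ↦ θ¹(x,q)` is continuous at `p`
(`0 < p ≤ 1`, `q ≥ 1`) then `θ⁰(p,q) = θ¹(p,q)`: the left limit of `θ¹` at `p` is at most `θ⁰(p,q)` (`θ¹(x) ≤ θ⁰(p)` for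
`x < p`). [cite: Grimmett2006, Thm. (5.16)(d)] -/
theorem thetaFree_eq_thetaWired_of_continuousAt_thetaWired (hq : 1 ≤ q) (hp : p ∈ Set.Ioc (0 : ℝ) 1)
    (hc : ContinuousAt (fun x : ℝ => thetaWired d x q) p) : thetaFree d p q = thetaWired d p q := by
  have hp' : p ∈ Set.Icc (0 : ℝ) 1 := ⟨hp.1.le, hp.2⟩
  refine le_antisymm (thetaFree_le_thetaWired hp' hq) ?_
  -- along `x ↑ p` inside `(0, p)`: `θ¹(x) ≤ θ⁰(p)`, and `θ¹(x) → θ¹(p)`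
  have hlim : Tendsto (fun x : ℝ => thetaWired d x q) (𝓝[Set.Ioo 0 p] p) (𝓝 (thetaWired d p q)) :=
    hc.tendsto.mono_left nhdsWithin_le_nhds
  have hev : ∀ᶠ x in 𝓝[Set.Ioo 0 p] p, thetaWired d x q ≤ thetaFree d p q :=
    eventually_nhdsWithin_of_forall fun x hx =>
      thetaWired_le_thetaFree_of_lt hq ⟨hx.1.le, hx.2.le.trans hp.2⟩ hp' hx.2
  haveI : (𝓝[Set.Ioo 0 p] p).NeBot := by
    rw [← mem_closure_iff_nhdsWithin_neBot, closure_Ioo hp.1.ne]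
    exact ⟨hp.1.le, le_rfl⟩
  exact le_of_tendsto hlim hev

/-! ### At the critical point: `T_W(q)` is continuity of `θ⁰(·,q)` (or of `θ¹(·,q)`) at `p_c(q)` -/

/-- **`T_W(q) ⟺ θ⁰(·,q)` is continuous at `p_c(q)`** (`d ≥ 2`, `q ≥ 1`): wired continuity at criticality
(`θ¹(p_c(q),q) = 0`) holds iff the FREE percolation probability is continuous at the critical point — its left limit
there is `0` (no percolation below `p_c`), its right limit is `θ¹(p_c(q),q)`. [cite: Grimmett2006, Thm. (5.16)(b)–(d) and the paragraph after it] -/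
theorem fkContinuityWired_iff_continuousAt_thetaFree (hd : 2 ≤ d) (hq : 1 ≤ q) :
    FKContinuityWired d q ↔ ContinuousAt (fun x : ℝ => thetaFree d x q) (rcCriticalProb d q) := by
  have hpc := rcCriticalProb_mem_Ioo hd hq
  have hpc' : rcCriticalProb d q ∈ Set.Icc (0 : ℝ) 1 := ⟨hpc.1.le, hpc.2.le⟩
  constructor
  · intro hW
    have h0 : thetaFree d (rcCriticalProb d q) q = 0 := free_of_wired hq hW
    rw [continuousAt_iff_continuous_left'_right']
    refine ⟨?_, ?_⟩
    · -- left: `θ⁰(x) = 0` for `0 ≤ x < p_c`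
      rw [ContinuousWithinAt, h0]
      refine tendsto_const_nhds.congr' ?_
      filter_upwards [Ioo_mem_nhdsLT hpc.1] with x hx
      refine (le_antisymm ?_ (thetaFree_nonneg _ _)).symm
      calc thetaFree d x q ≤ thetaWired d x q := thetaFree_le_thetaWired ⟨hx.1.le, hx.2.le.trans hpc'.2⟩ hq
        _ = 0 := thetaWired_eq_zero_of_lt_rcCriticalProb hq hx.1.le hx.2
    · -- right: the right limit is `θ¹(p_c) = 0 = θ⁰(p_c)`
      rw [ContinuousWithinAt, h0]
      have h := tendsto_thetaFree_nhdsGT (d := d) hq ⟨hpc.1.le, hpc.2⟩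
      rwa [show thetaWired d (rcCriticalProb d q) q = 0 from hW] at h
  · intro hc
    -- continuity ⇒ `θ⁰(p_c) = θ¹(p_c)`, and `θ⁰(p_c)` = the left limit `0`
    have heq := thetaFree_eq_thetaWired_of_continuousAt_thetaFree hq ⟨hpc.1.le, hpc.2⟩ hc
    have hleft : Tendsto (fun x : ℝ => thetaFree d x q) (𝓝[<] rcCriticalProb d q) (𝓝 0) := by
      refine tendsto_const_nhds.congr' ?_
      filter_upwards [Ioo_mem_nhdsLT hpc.1] with x hx
      refine (le_antisymm ?_ (thetaFree_nonneg _ _)).symm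
      calc thetaFree d x q ≤ thetaWired d x q := thetaFree_le_thetaWired ⟨hx.1.le, hx.2.le.trans hpc'.2⟩ hq
        _ = 0 := thetaWired_eq_zero_of_lt_rcCriticalProb hq hx.1.le hx.2
    have h0 : thetaFree d (rcCriticalProb d q) q = 0 :=
      tendsto_nhds_unique (hc.tendsto.mono_left nhdsWithin_le_nhds) hleft
    show thetaWired d (rcCriticalProb d q) q = 0
    rw [← heq, h0]

/-- **`T_W(q) ⟺ θ¹(·,q)` is continuous at `p_c(q)`** (`d ≥ 2`, `q ≥ 1`): `θ¹(·,q)` is right-continuous and vanishes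
below `p_c(q)`, so it is continuous at `p_c(q)` iff `θ¹(p_c(q),q) = 0`. [cite: Grimmett2006, Thm. (5.16)(b) and the paragraph after it] -/
theorem fkContinuityWired_iff_continuousAt_thetaWired (hd : 2 ≤ d) (hq : 1 ≤ q) :
    FKContinuityWired d q ↔ ContinuousAt (fun x : ℝ => thetaWired d x q) (rcCriticalProb d q) := by
  have hpc := rcCriticalProb_mem_Ioo hd hq
  have hleft : Tendsto (fun x : ℝ => thetaWired d x q) (𝓝[<] rcCriticalProb d q) (𝓝 0) := by
    refine tendsto_const_nhds.congr' ?_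
    filter_upwards [Ioo_mem_nhdsLT hpc.1] with x hx
    exact (thetaWired_eq_zero_of_lt_rcCriticalProb hq hx.1.le hx.2).symm
  constructor
  · intro hW
    rw [continuousAt_iff_continuous_left'_right']
    refine ⟨?_, tendsto_thetaWired_nhdsGT (d := d) hq ⟨hpc.1.le, hpc.2⟩⟩
    rw [ContinuousWithinAt, show thetaWired d (rcCriticalProb d q) q = 0 from hW]
    exact hleft
  · intro hc
    exact tendsto_nhds_unique (hc.tendsto.mono_left nhdsWithin_le_nhds) hleft

end Summit.CriticalPhenomena.PercolationContinuityZ3.Theorems.FK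

end
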